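/-
Copyright (c) 2026 the pub-hodgecm-mathlib formalisation cell (harness21).  Prover seat hodgecm-mathlib-K2Liu-p02 (g9), Track B «K2-LIT» ∕ hLiu418
#184♮, Road I v3, unit U5 «THE CLOSE», FACE-D₀ row `h2₂`: the (B1c′) tie AT ONE FINITE PLACE `v` — the `ρf`∕`hρf` letters of ★ p864051 at K2E3-p23 (g8)'s
instance `ι_v : N_Δ(L⁺_v) →* N_Δ(𝔸)`, in BOTH spellings of the chirp parameter (abstract `c_q` ∕ ★ p863869's closed form).  THEOREMS ONLY.
-/
import Summits.HodgeConjecture.HodgeConjecture.Theorems.K2LiuFirstTermLineLiftRankRowCayleyFst   -- this seat ★ p864051: `h2Row_thetaSide_of_lineCayley_fst`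
import Summits.HodgeConjecture.HodgeConjecture.Theorems.K2LiuLinePairChirpAdditive               -- this seat ★ p864161: `exists_rho_f`
import Summits.HodgeConjecture.HodgeConjecture.Theorems.K2LiuSiegelUnipotentLocalDefs             -- ★ `unipDeltaLoc`, `locToAdelic_mem_unipDelta`
import Summits.HodgeConjecture.HodgeConjecture.Theorems.K2LiuFourierCoeffDeltaLinear              -- ★ (c) `exists_linear_fourierCoeffDelta`
import Mathlib.Topology.ContinuousMap.Algebra                                                    -- `continuousSubmodule`
import HarnessLib

/-!
# K2_Liu road (hLiu418 = stmt-HodgeConjecture-24832), FACE-D₀ row `h2₂`: THE `ρf`∕`hρf` LETTERS AT THE PLACE `v`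

Cell `pub/hodgecm-mathlib` (D-0151), Track B, build stream 29; helper lane `--supports stmt-HodgeConjecture-24832 --as helper`, count-neutral.

★ p864051 `K2LiuFirstTermLineLiftRankRowCayleyFst.h2Row_thetaSide_of_lineCayley_fst` is ★ p863332's `h2₂`-theta head keyed on `(hX) (hρf)`, with `hρf` spelt on the
ABSTRACT chirp parameter `c_{q_{ι z}}` of the line Cayley mover; K2E3-p23 (g8)'s S-letter package (★ p864061 ∕ p864126 ∕ p864243, PART 3 in flight) reads the chirp
through ★ p863869's CLOSED FORM `c_q = 1ᵀ · reindex (a′ • J₂ · Res(−X−X) · D₂(⅟2))`.  This file supplies, at p23's instance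
`Z := ↥(unipDeltaLoc … v)`, `ι_v z := locToAdelic v z`:
* §1 **`exists_rho_f_at`** — ONE representation `ρf` of `N_Δ(L⁺_v)` on `𝒮(𝔸_f^{n″})` with `hρf` in BOTH spellings (★ p864161 `exists_rho_f` at
  `ι := (locToAdelic v).comp subtype` + ★ p863869 `aMat_cMat_lineKappa_of_mem_unipDelta`), so that the abstract clause feeds ★ p864051 and the closed-form clause
  feeds p23's `exists_letters`.
* §2 (generic `Z`, S-letters still by value) **`fourierCoeffDelta_thetaLift_eq_zero_of_lineCayley_cont`** — the `S`-th coefficient of EVERY lift vanishes at EVERY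
  `h ∈ H(𝔸)`, with ★ p863332's auxiliary class letters `Bl hBl P hPB cfS hcf` DISCHARGED (`P := continuousSubmodule`, ★ (t), ★ (c); new letters: `νN` finite on
  compacts and the weight supported in a compact `K` — ★ `K2LiuFirstTermHolCutRows`' `hK`, `hβK`); **`h2Row_thetaSide_of_lineCayley_cont`** — the row on ANY
  class `P` with ANY coefficient map `cfS` (at FACE-D₀: `P := P_k`, `cfS := cf (dict β)`; the hol cut does NOT contain every lift, so the discharge is needed).

No definition, no instance, no notation, no named-fact hypothesis, no `sorry`; axioms ⊆ {propext, Classical.choice, Quot.sound}.  HONEST LABEL: HC_CM is proved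
only modulo the 7 printed citations (2 remaining named inputs: hLiu418 = stmt-HodgeConjecture-24832, h413 = stmt-HodgeConjecture-24833) until rung 0 closes; this file
moves no counter.

References: [Weil1964] A. Weil, Acta Math. 111 (1964), Chap. I n° 34 p. 184, Chap. III n° 46 p. 202; [Kudla1994] S. S. Kudla, Israel J. Math. 87 (1994), §3;
[MoeglinWaldspurger1995] I.2.1; [Liu2021] App. B Prop. B.8 p. 104.
-/

set_option autoImplicit false
set_option linter.dupNamespace false
-- the line-pair carriers elaborate to very large types; elaborate sequentially (as in ★ `K2LiuFirstTermLineLiftRankRowModelConj`)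
set_option Elab.async false

noncomputable section

open NumberField NumberField.mixedEmbedding MeasureTheory IsDedekindDomain
open scoped Matrix ComplexOrder ENNReal TensorProduct SchwartzMap Classical  -- `Classical`: as ★ p863332

namespace Summit.HodgeConjecture.HodgeConjecture.Cruxes.HLiu418.K2LiuFirstTermLineLiftRankRowAtPlace

open Literature.NumberTheory.Automorphic Literature.NumberTheory.Automorphic.UnitaryGroup
open Literature.NumberTheory.Automorphic.UnitaryGroup.QuadraticCoordinates
open Literature.NumberTheory.Automorphic.IdeleClassGroup
open Literature.NumberTheory.Automorphic.Liu2021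
open Literature.NumberTheory.Automorphic.Liu2021.Def411WeilCarriers
open Literature.NumberTheory.Automorphic.Liu2021.Def411WeilCarriersDoubling
open Literature.NumberTheory.GelbartRogawski1991 Literature.NumberTheory.GelbartRogawski1991.UnitaryDualPair
open Literature.NumberTheory.GelbartRogawski1991.GRConstruction
open Literature.NumberTheory.GaloisRepresentations
open Literature.NumberTheory.Weil1964
open Literature.RepresentationTheory Literature.RepresentationTheory.Liu2021
open Literature.RepresentationTheory.HeisenbergGroup
open Literature.NumberTheory.K2Lit.DoubledLineTheta Literature.NumberTheory.K2Lit.SiegelDoubled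
open Literature.MeasureTheory.Group
open Summit.HodgeConjecture.HodgeConjecture.Cruxes.HLiu418.K2LiuSiegelUnipotentFourierDefs
open Summit.HodgeConjecture.HodgeConjecture.Cruxes.HLiu418.K2LiuSiegelUnipotentCharacters
open Summit.HodgeConjecture.HodgeConjecture.Cruxes.HLiu418.K2LiuSiegelUnipotentLocalDefs
open Summit.HodgeConjecture.HodgeConjecture.Cruxes.HLiu418.K2LiuUnipotentCoveringWeight
open Summit.HodgeConjecture.HodgeConjecture.Cruxes.HLiu418.K2LiuFirstTermLineLiftRankRow
open Summit.HodgeConjecture.HodgeConjecture.Cruxes.HLiu418.K2LiuLinePairCayleySiegel (lineCayleyMover_mem_symplecticGroup)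
open Summit.HodgeConjecture.HodgeConjecture.Cruxes.HLiu418.K2LiuLinePairCayleySiegelUnipotent (aMat_cMat_lineKappa_of_mem_unipDelta)
open Summit.HodgeConjecture.HodgeConjecture.Cruxes.HLiu418.K2LiuLinePairChirpAdditive (exists_rho_f)
open Summit.HodgeConjecture.HodgeConjecture.Cruxes.HLiu418.K2LiuFirstTermLineLiftRankRowCayleyFst (fourierCoeffDelta_thetaLift_eq_zero_of_lineCayley_fst)
open Summit.HodgeConjecture.HodgeConjecture.Cruxes.HLiu418.K2LiuDoubledLineThetaLiftLinear (exists_linearLift)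
open Summit.HodgeConjecture.HodgeConjecture.Cruxes.HLiu418.K2LiuFourierCoeffDeltaLinear (exists_linear_fourierCoeffDelta)
open Summit.HodgeConjecture.HodgeConjecture.Cruxes.HLiu418.K2LiuLineThetaFunctionalOfRecord (continuous_thetaFunctional)

section RhoF

variable (L : Type) [Field L] [NumberField L] [IsCMField L]
variable {N n : ℕ} (e : Fin N × Fin 1 ≃ Fin n)
  (dV : Fin N → L) (hdV : ∀ i, IsCMField.complexConj L (dV i) = dV i)
  (dW : Fin 1 → L) (hdW : ∀ i, IsCMField.complexConj L (dW i) = dW i)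
  {n'' : ℕ} (e₁ : Fin (n + n) × Fin 1 ≃ Fin n'') (hdV0 : ∀ i, dV i ≠ 0) (hdW0 : ∀ i, dW i ≠ 0) (a' : (Fp L)ˣ)
  (v : HeightOneSpectrum (𝓞 (Fp L)))

/-! ## §1 The `ρf`∕`hρf` letters at `ι_v`, in both spellings of the chirp parameter -/

set_option maxHeartbeats 1000000 in -- the statement carries the line datum's `toSp` term and ★ p863869's closed form (default RED measured on ★ p864161's head)
/-- **THE `ρf`∕`hρf` LETTERS AT THE PLACE `v`.**  There is ONE representation `ρf` of `N_Δ(L⁺_v)` on `𝒮(𝔸_f^{n″})` acting by the finite chirps of the line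
Cayley mover at `ι_v z`, read (a) on the ABSTRACT chirp parameter `(−⅟2) • c_{q_{ι_v z}}` (★ p864161 `exists_rho_f` at `ι := ι_v`; this is ★ p864051's `hρf`) and
(b) on ★ p863869's CLOSED FORM `c_q = 1ᵀ · reindex (a′ • J₂ · Res(−X−X) · D₂(⅟2))` at `X = X(ι_v z)` (`aMat_cMat_lineKappa_of_mem_unipDelta`; this is the input of
K2E3-p23's S-letter package). [cite: Weil1964, Chap. I n° 34 p. 184, Chap. III n° 46 p. 202] [cite: Kudla1994, §3] [cite: Liu2021, App. B Prop. B.8 p. 104] -/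
theorem exists_rho_f_at :
    ∃ ρf : Representation ℂ ↥(unipDeltaLoc L e dV hdV dW hdW v) (FinSB (Fp L) (Fin n'')),
      (∀ (z : ↥(unipDeltaLoc L e dV hdV dW hdW v)) (φ : FinSB (Fp L) (Fin n'')), ρf z φ =
        finMulLM (finSdChar ((((-⅟(2 : AdeleRing (𝓞 (Fp L)) (Fp L))) • SiegelParabolicPi.cMat (ratSp (Fp L) (adelicGram (Fp L) e₁ (realDiagonal L (dD L e dV hdV dW hdW) (dD_conj L e dV hdV dW hdW)) (TW (Fp L) a'))
            (isUnit_det_adelicGram (Fp L) e₁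
              (isUnit_det_realDiagonal L (dD L e dV hdV dW hdW) (dD_conj L e dV hdV dW hdW) (dD_ne_zero L e dV hdV dW hdW hdV0 hdW0))
              (isUnit_det_TW (Fp L) a')) (⟨_, lineCayleyMover_mem_symplecticGroup (Fp L) n ((Equiv.prodUnique (Fin (n + n)) (Fin 1)).symm.trans e₁) (Units.mul_inv a')⟩ :
              Matrix.symplecticGroup (Fin n'') (Fp L)) *
          toSp (Fp L) L (IsCMField.complexConj L) (n + n) 1 e₁ (Matrix.diagonal (dD L e dV hdV dW hdW)) (JW (Fp L) L a')
            (complexConj_imagUnit L) (imagUnit_ne_zero L) (imagUnit_mul_self L)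
            (realDiagonal_isSymm L (dD L e dV hdV dW hdW) (dD_conj L e dV hdV dW hdW)) (isSymm_TW (Fp L) a')
            (realDiagonal_map L (dD L e dV hdV dW hdW) (dD_conj L e dV hdV dW hdW)).symm (JW_eq (Fp L) L a')
            (UnitaryGroup.adelicInl (Fp L) L (IsCMField.complexConj L) (n + n) 1 (Matrix.diagonal (dD L e dV hdV dW hdW)) (JW (Fp L) L a')
              (toDiagA L e dV hdV dW hdW
                (locToAdelic L e dV hdV dW hdW v (z : UnitaryGroup.localPi L (IsCMField.complexConj L) (n + n) (hermD L e dV hdV dW hdW) v)))) *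
          (ratSp (Fp L) (adelicGram (Fp L) e₁ (realDiagonal L (dD L e dV hdV dW hdW) (dD_conj L e dV hdV dW hdW)) (TW (Fp L) a'))
            (isUnit_det_adelicGram (Fp L) e₁
              (isUnit_det_realDiagonal L (dD L e dV hdV dW hdW) (dD_conj L e dV hdV dW hdW) (dD_ne_zero L e dV hdV dW hdW hdV0 hdW0))
              (isUnit_det_TW (Fp L) a')) (⟨_, lineCayleyMover_mem_symplecticGroup (Fp L) n ((Equiv.prodUnique (Fin (n + n)) (Fin 1)).symm.trans e₁) (Units.mul_inv a')⟩ :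
              Matrix.symplecticGroup (Fin n'') (Fp L)))⁻¹))).map
          (RingHom.snd (InfiniteAdeleRing (Fp L)) (FiniteAdeleRing (𝓞 (Fp L)) (Fp L))))) (isLocallyConstant_finSdChar _) φ) ∧
      (∀ (z : ↥(unipDeltaLoc L e dV hdV dW hdW v)) (φ : FinSB (Fp L) (Fin n'')), ρf z φ =
        finMulLM (finSdChar (((-⅟(2 : (AdeleRing (𝓞 (Fp L)) (Fp L)))) • ((1 : Matrix (Fin n'') (Fin n'') (AdeleRing (𝓞 (Fp L)) (Fp L)))ᵀ *
          Matrix.reindex ((Equiv.prodUnique (Fin (n + n)) (Fin 1)).symm.trans e₁) ((Equiv.prodUnique (Fin (n + n)) (Fin 1)).symm.trans e₁)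
            (Matrix.reindex (e₂ (n := n)) (e₂ (n := n))
            ((algebraMap (Fp L) (AdeleRing (𝓞 (Fp L)) (Fp L)) (a' : Fp L)) •
            (Matrix.fromBlocks 0 1 (-((2 : (AdeleRing (𝓞 (Fp L)) (Fp L))) • (1 : Matrix (Fin n) (Fin n) (AdeleRing (𝓞 (Fp L)) (Fp L))))) 0 *
            Matrix.fromBlocks ((-((blk L e dV hdV dW hdW (locToAdelic L e dV hdV dW hdW v (z : UnitaryGroup.localPi L (IsCMField.complexConj L) (n + n) (hermD L e dV hdV dW hdW) v))).toBlocks₁₂) - ((blk L e dV hdV dW hdW (locToAdelic L e dV hdV dW hdW v (z : UnitaryGroup.localPi L (IsCMField.complexConj L) (n + n) (hermD L e dV hdV dW hdW) v))).toBlocks₁₂)).map (re (quadraticAdeleEquiv (Fp L) L (IsCMField.complexConj L) (complexConj_imagUnit L) (imagUnit_ne_zero L)).toAddEquiv)) ((algebraMap (Fp L) (AdeleRing (𝓞 (Fp L)) (Fp L)) (imagUnitSq L)) • ((-((blk L e dV hdV dW hdW (locToAdelic L e dV hdV dW hdW v (z : UnitaryGroup.localPi L (IsCMField.complexConj L) (n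 + n) (hermD L e dV hdV dW hdW) v))).toBlocks₁₂) - ((blk L e dV hdV dW hdW (locToAdelic L e dV hdV dW hdW v (z : UnitaryGroup.localPi L (IsCMField.complexConj L) (n + n) (hermD L e dV hdV dW hdW) v))).toBlocks₁₂)).map (im (quadraticAdeleEquiv (Fp L) L (IsCMField.complexConj L) (complexConj_imagUnit L) (imagUnit_ne_zero L)).toAddEquiv) * ((gramR L e dV hdV dW hdW).map (algebraMap (Fp L) (AdeleRing (𝓞 (Fp L)) (Fp L))))⁻¹))
              (((gramR L e dV hdV dW hdW).map (algebraMap (Fp L) (AdeleRing (𝓞 (Fp L)) (Fp L)))) * (-((blk L e dV hdV dW hdW (locToAdelic L e dV hdV dW hdW v (z : UnitaryGroup.localPi L (IsCMField.complexConj L) (n + n) (hermD L e dV hdV dW hdW) v))).toBlocks₁₂) - ((blk L e dV hdV dW hdW (locToAdelic L e dV hdV dW hdW v (z : UnitaryGroup.localPi L (IsCMField.complexConj L) (n + n) (hermD L e dV hdV dW hdW) v))).toBlocks₁₂)).map (im (quadraticAdeleEquiv (Fp L) L (IsCMField.complexConj L) (complexConj_imagUnit L) (imagUnit_ne_zero L)).toAddEquiv))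 (((gramR L e dV hdV dW hdW).map (algebraMap (Fp L) (AdeleRing (𝓞 (Fp L)) (Fp L)))) * (-((blk L e dV hdV dW hdW (locToAdelic L e dV hdV dW hdW v (z : UnitaryGroup.localPi L (IsCMField.complexConj L) (n + n) (hermD L e dV hdV dW hdW) v))).toBlocks₁₂) - ((blk L e dV hdV dW hdW (locToAdelic L e dV hdV dW hdW v (z : UnitaryGroup.localPi L (IsCMField.complexConj L) (n + n) (hermD L e dV hdV dW hdW) v))).toBlocks₁₂)).map (re (quadraticAdeleEquiv (Fp L) L (IsCMField.complexConj L) (complexConj_imagUnit L) (imagUnit_ne_zero L)).toAddEquiv) * ((gramR L e dV hdV dW hdW).map (algebraMap (Fp L) (AdeleRing (𝓞 (Fp L)) (Fp L))))⁻¹) *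
            Matrix.fromBlocks ((⅟(2 : (AdeleRing (𝓞 (Fp L)) (Fp L)))) • (1 : Matrix (Fin n) (Fin n) (AdeleRing (𝓞 (Fp L)) (Fp L)))) 0 0 1))))).map
          (RingHom.snd (InfiniteAdeleRing (Fp L)) (FiniteAdeleRing (𝓞 (Fp L)) (Fp L))))) (isLocallyConstant_finSdChar _) φ) := by
  obtain ⟨ρf, hρf⟩ := exists_rho_f L e dV hdV dW hdW e₁ hdV0 hdW0 a'
    ((locToAdelic L e dV hdV dW hdW v).comp (unipDeltaLoc L e dV hdV dW hdW v).subtype) fun z => locToAdelic_mem_unipDelta L e dV hdV dW hdW z.2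
  have hρf₁ : ∀ (z : ↥(unipDeltaLoc L e dV hdV dW hdW v)) (φ : FinSB (Fp L) (Fin n'')), ρf z φ =
      finMulLM (finSdChar ((((-⅟(2 : AdeleRing (𝓞 (Fp L)) (Fp L))) • SiegelParabolicPi.cMat (ratSp (Fp L) (adelicGram (Fp L) e₁ (realDiagonal L (dD L e dV hdV dW hdW) (dD_conj L e dV hdV dW hdW)) (TW (Fp L) a'))
          (isUnit_det_adelicGram (Fp L) e₁
            (isUnit_det_realDiagonal L (dD L e dV hdV dW hdW) (dD_conj L e dV hdV dW hdW) (dD_ne_zero L e dV hdV dW hdW hdV0 hdW0))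
            (isUnit_det_TW (Fp L) a')) (⟨_, lineCayleyMover_mem_symplecticGroup (Fp L) n ((Equiv.prodUnique (Fin (n + n)) (Fin 1)).symm.trans e₁) (Units.mul_inv a')⟩ :
            Matrix.symplecticGroup (Fin n'') (Fp L)) *
        toSp (Fp L) L (IsCMField.complexConj L) (n + n) 1 e₁ (Matrix.diagonal (dD L e dV hdV dW hdW)) (JW (Fp L) L a')
          (complexConj_imagUnit L) (imagUnit_ne_zero L) (imagUnit_mul_self L)
          (realDiagonal_isSymm L (dD L e dV hdV dW hdW) (dD_conj L e dV hdV dW hdW)) (isSymm_TW (Fp L) a')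
          (realDiagonal_map L (dD L e dV hdV dW hdW) (dD_conj L e dV hdV dW hdW)).symm (JW_eq (Fp L) L a')
          (UnitaryGroup.adelicInl (Fp L) L (IsCMField.complexConj L) (n + n) 1 (Matrix.diagonal (dD L e dV hdV dW hdW)) (JW (Fp L) L a')
            (toDiagA L e dV hdV dW hdW
              (locToAdelic L e dV hdV dW hdW v (z : UnitaryGroup.localPi L (IsCMField.complexConj L) (n + n) (hermD L e dV hdV dW hdW) v)))) *
        (ratSp (Fp L) (adelicGram (Fp L) e₁ (realDiagonal L (dD L e dV hdV dW hdW) (dD_conj L e dV hdV dW hdW)) (TW (Fp L) a'))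
          (isUnit_det_adelicGram (Fp L) e₁
            (isUnit_det_realDiagonal L (dD L e dV hdV dW hdW) (dD_conj L e dV hdV dW hdW) (dD_ne_zero L e dV hdV dW hdW hdV0 hdW0))
            (isUnit_det_TW (Fp L) a')) (⟨_, lineCayleyMover_mem_symplecticGroup (Fp L) n ((Equiv.prodUnique (Fin (n + n)) (Fin 1)).symm.trans e₁) (Units.mul_inv a')⟩ :
            Matrix.symplecticGroup (Fin n'') (Fp L)))⁻¹))).map
        (RingHom.snd (InfiniteAdeleRing (Fp L)) (FiniteAdeleRing (𝓞 (Fp L)) (Fp L))))) (isLocallyConstant_finSdChar _) φ :=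
    hρf
  refine ⟨ρf, hρf₁, fun z φ => ?_⟩
  rw [hρf₁ z φ, (aMat_cMat_lineKappa_of_mem_unipDelta L e dV hdV hdV0 dW hdW hdW0 e₁ a' (isUnit_det_adelicGram (Fp L) e₁
            (isUnit_det_realDiagonal L (dD L e dV hdV dW hdW) (dD_conj L e dV hdV dW hdW) (dD_ne_zero L e dV hdV dW hdW hdV0 hdW0))
            (isUnit_det_TW (Fp L) a'))
    (JW (Fp L) L a') (realDiagonal_isSymm L (dD L e dV hdV dW hdW) (dD_conj L e dV hdV dW hdW)) (isSymm_TW (Fp L) a')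
    (realDiagonal_map L (dD L e dV hdV dW hdW) (dD_conj L e dV hdV dW hdW)).symm (JW_eq (Fp L) L a') (locToAdelic_mem_unipDelta L e dV hdV dW hdW z.2)).2]

end RhoF

/-! ## §2 ★ p864051's two heads with the auxiliary class letters `Bl hBl P hPB cfS hcf` DISCHARGED on the class of continuous forms

★ p863332 (hence ★ p864051) reads the functional `Λ_S Φ := (B(Φ, fw))_S(1)` through an auxiliary class `P ∋ B(Φ, fw)` (ALL `Φ`) with a linear coefficient map
`cfS` on `↥P`.  At FACE-D₀ the class of record is the `P_k` hol cut, which does NOT contain every lift; so the auxiliary class must be discharged HERE, once: take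
`P := continuousSubmodule` (every lift is continuous, ★ p862640 `continuous_thetaFunctional`), `Bl :=` ★ (t) `exists_linearLift`, `cfS :=` ★ (c)
`exists_linear_fourierCoeffDelta` (letters: `νN` finite on compacts, the covering weight supported in a compact `K` — the letters `hK`, `hβK` of ★ `K2LiuFirstTermHolCutRows`).
The row head then holds for ANY class `P` and ANY coefficient map `cfS` on it (★ `coeff_comp_codRestrict_thetaFunctional_eq_zero`). -/

section Cont

variable (L : Type) [Field L] [NumberField L] [IsCMField L]
variable {N n : ℕ} (e : Fin N × Fin 1 ≃ Fin n)
  (dV : Fin N → L) (hdV : ∀ i, IsCMField.complexConj L (dV i) = dV i)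
  (dW : Fin 1 → L) (hdW : ∀ i, IsCMField.complexConj L (dW i) = dW i)
  {n'' : ℕ} (e₁ : Fin (n + n) × Fin 1 ≃ Fin n'')
  (hdV0 : ∀ i, dV i ≠ 0) (hdW0 : ∀ i, dW i ≠ 0)
  (lam : IdeleClassGroup L →ₜ* Circle) (hlam : IsConjugateSymplectic L lam) (a' : (Fp L)ˣ)
  (hρ : HasThetaMajorants fun
      (p : ↥(UnitaryGroup.adelic (Fp L) L (IsCMField.complexConj L) (n + n) (Matrix.diagonal (dD L e dV hdV dW hdW))) ×
        ↥(UnitaryGroup.adelic (Fp L) L (IsCMField.complexConj L) 1 (JW (Fp L) L a')))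
      (Φ : piSchwartzBruhat (Fp L) (Fin n'')) =>
        pairRep (Fp L) L (IsCMField.complexConj L) (n + n) 1 e₁ (Matrix.diagonal (dD L e dV hdV dW hdW)) (JW (Fp L) L a')
          (chiSplittingLine L e₁ (dD L e dV hdV dW hdW) (dD_conj L e dV hdV dW hdW) (dD_ne_zero L e dV hdV dW hdW hdV0 hdW0)
            (toHeckeCharacter L lam) (isUnitary_toHeckeCharacter L lam)
            ((isOscillatorChar_toHeckeCharacter_iff lam).mpr hlam) (TW (Fp L) a')
            (isUnit_det_TW (Fp L) a') (JW (Fp L) L a') (JW_eq (Fp L) L a'))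
          p Φ)
  [MeasurableSpace (↥(UnitaryGroup.adelic (Fp L) L (IsCMField.complexConj L) 1 (JW (Fp L) L a')) ⧸
    (UnitaryGroup.toAdelic (Fp L) L (IsCMField.complexConj L) 1 (JW (Fp L) L a')).range)]
  [BorelSpace (↥(UnitaryGroup.adelic (Fp L) L (IsCMField.complexConj L) 1 (JW (Fp L) L a')) ⧸
    (UnitaryGroup.toAdelic (Fp L) L (IsCMField.complexConj L) 1 (JW (Fp L) L a')).range)]
  (μW : Measure (↥(UnitaryGroup.adelic (Fp L) L (IsCMField.complexConj L) 1 (JW (Fp L) L a')) ⧸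
    (UnitaryGroup.toAdelic (Fp L) L (IsCMField.complexConj L) 1 (JW (Fp L) L a')).range)) [IsFiniteMeasure μW]
  (fw : C(↥(UnitaryGroup.adelic (Fp L) L (IsCMField.complexConj L) 1 (JW (Fp L) L a')) ⧸
    (UnitaryGroup.toAdelic (Fp L) L (IsCMField.complexConj L) 1 (JW (Fp L) L a')).range, ℂ))
  [MeasurableSpace (unipDelta L e dV hdV dW hdW)] [BorelSpace (unipDelta L e dV hdV dW hdW)]
  (νN : Measure (unipDelta L e dV hdV dW hdW)) [νN.IsMulLeftInvariant] [IsFiniteMeasureOnCompacts νN]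
  {βw : unipDelta L e dV hdV dW hdW → ℝ≥0∞} (hβ : IsCoveringWeight (unipDeltaRat L e dV hdV dW hdW) βw) (hβtop : ∫⁻ u, βw u ∂νN ≠ ∞)
  {K : Set (unipDelta L e dV hdV dW hdW)} (hK : IsCompact K) (hβK : ∀ u, βw u ≤ K.indicator 1 u)
  (S : Matrix (Fin n) (Fin n) L)
  -- (ii) the σ-explicit line model at one finite place, on the finite-adelic Schwartz–Bruhat space (★ p863332's binders :106–:121 verbatim)
  {R : Type*} [CommRing R] {F : Type*} [Field F] [Algebra F R]
  (σ : R →+* R) (hσ : ∀ x, σ (σ x) = x) (hσF : ∀ c : F, σ (algebraMap F R c) = algebraMap F R c)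
  (π : Matrix (Fin 2) (Fin 2) R →ₗ[F] Matrix (Fin 2) (Fin 2) R →ₗ[F] F)
  (hπ : ∀ H : Matrix (Fin 2) (Fin 2) R, (H.map σ)ᵀ = H → H ≠ 0 → ∃ s : Matrix (Fin 2) (Fin 2) R, (s.map σ)ᵀ = s ∧ π s H ≠ 0)
  (ψ : AddChar F Circle) (hψ : ∃ t : F, ((ψ t : Circle) : ℂ) ≠ 1)
  {Z : Type*} [Group Z] (ρf : Representation ℂ Z (FinSB (Fp L) (Fin n'')))
  (b : Z → Matrix (Fin 2) (Fin 2) R) (hb : ∀ s : Matrix (Fin 2) (Fin 2) R, (s.map σ)ᵀ = s → ∃ z, b z = s)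
  (a : R) (ha : σ a = a) (v : (Fin n'' → FiniteAdeleRing (𝓞 (Fp L)) (Fp L)) → Fin 2 → R)
  (hu : ∀ z, IsLocallyConstant fun x => ((ψ (π (b z) (a • Matrix.vecMulVec (⇑σ ∘ v x) (v x))) : Circle) : ℂ))
  (hρm : ∀ (z : Z) (φ : FinSB (Fp L) (Fin n'')),
    ((ρf z φ : FinSB (Fp L) (Fin n'')) : (Fin n'' → FiniteAdeleRing (𝓞 (Fp L)) (Fp L)) → ℂ) =
      (fun x => ((ψ (π (b z) (a • Matrix.vecMulVec (⇑σ ∘ v x) (v x))) : Circle) : ℂ)) * φ)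
  (βloc : Matrix (Fin 2) (Fin 2) R) (hherm : (βloc.map σ)ᵀ = βloc) (hdet : βloc.det ≠ 0)
  (χ : Z →* ℂˣ) (hχ : ∀ z, ((χ z : ℂˣ) : ℂ) = ((ψ (π (b z) βloc) : Circle) : ℂ))
  -- (iii) the embedding `ι : Z → N_Δ(𝔸)` and the character match `χ = ψ_S ∘ ι`
  (ι : Z → unipDelta L e dV hdV dW hdW)
  (hχS : ∀ z : Z, ((χ z : ℂˣ) : ℂ) = (unipDeltaChar L e dV hdV dW hdW S (((ι z : unipDelta L e dV hdV dW hdW)) : HA L e dV hdV dW hdW) : ℂ))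

include hβ hβtop hK hβK hσ hσF hπ hψ hb ha hu hρm hherm hdet hχ hχS

set_option maxHeartbeats 1000000 in -- idem
/-- **THE `S`-th FOURIER COEFFICIENT OF EVERY DOUBLED LINE THETA LIFT VANISHES EVERYWHERE ON `H(𝔸)`** (line Cayley mover, keyed on `hX`, NO auxiliary class):
at `h` the coefficient is the coefficient at `1` of the lift of the Weil translate `ω(toDiagA h, 1)Φ` (★ `fourierCoeffDelta_thetaLift_eq_at_one`), and at `1` it is
★ p864051 `fourierCoeffDelta_thetaLift_eq_zero_of_lineCayley_fst` with `P := continuousSubmodule`, `Bl :=` ★ (t), `cfS :=` ★ (c) (`hPB`: every lift is continuous,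
★ `continuous_thetaFunctional`). [cite: Rallis1984, §4] [cite: KudlaRallis1994, §3] [cite: Weil1964, Chap. I n° 13, Chap. III n° 37–38, n° 41 Thm 6 p. 193]
[cite: MoeglinWaldspurger1995, I.2.6] -/
theorem fourierCoeffDelta_thetaLift_eq_zero_of_lineCayley_cont
    (hX : ∀ z, ((blk L e dV hdV dW hdW ((ι z : ↥(unipDelta L e dV hdV dW hdW)) : HA L e dV hdV dW hdW)).toBlocks₁₂).map (UnitaryGroup.adeleFst L) = 0)
    (hρf : ∀ (z : Z) (φ : FinSB (Fp L) (Fin n'')), ρf z φ =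
      finMulLM (finSdChar ((((-⅟(2 : AdeleRing (𝓞 (Fp L)) (Fp L))) • SiegelParabolicPi.cMat (ratSp (Fp L) (adelicGram (Fp L) e₁ (realDiagonal L (dD L e dV hdV dW hdW) (dD_conj L e dV hdV dW hdW)) (TW (Fp L) a'))
          (isUnit_det_adelicGram (Fp L) e₁
            (isUnit_det_realDiagonal L (dD L e dV hdV dW hdW) (dD_conj L e dV hdV dW hdW) (dD_ne_zero L e dV hdV dW hdW hdV0 hdW0))
            (isUnit_det_TW (Fp L) a')) (⟨_, lineCayleyMover_mem_symplecticGroup (Fp L) n ((Equiv.prodUnique (Fin (n + n)) (Fin 1)).symm.trans e₁) (Units.mul_inv a')⟩ :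
            Matrix.symplecticGroup (Fin n'') (Fp L)) *
        toSp (Fp L) L (IsCMField.complexConj L) (n + n) 1 e₁ (Matrix.diagonal (dD L e dV hdV dW hdW)) (JW (Fp L) L a')
          (complexConj_imagUnit L) (imagUnit_ne_zero L) (imagUnit_mul_self L)
          (realDiagonal_isSymm L (dD L e dV hdV dW hdW) (dD_conj L e dV hdV dW hdW)) (isSymm_TW (Fp L) a')
          (realDiagonal_map L (dD L e dV hdV dW hdW) (dD_conj L e dV hdV dW hdW)).symm (JW_eq (Fp L) L a')
          (UnitaryGroup.adelicInl (Fp L) L (IsCMField.complexConj L) (n + n) 1 (Matrix.diagonal (dD L e dV hdV dW hdW)) (JW (Fp L) L a')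
            (toDiagA L e dV hdV dW hdW ((ι z : ↥(unipDelta L e dV hdV dW hdW)) : HA L e dV hdV dW hdW))) *
        (ratSp (Fp L) (adelicGram (Fp L) e₁ (realDiagonal L (dD L e dV hdV dW hdW) (dD_conj L e dV hdV dW hdW)) (TW (Fp L) a'))
          (isUnit_det_adelicGram (Fp L) e₁
            (isUnit_det_realDiagonal L (dD L e dV hdV dW hdW) (dD_conj L e dV hdV dW hdW) (dD_ne_zero L e dV hdV dW hdW hdV0 hdW0))
            (isUnit_det_TW (Fp L) a')) (⟨_, lineCayleyMover_mem_symplecticGroup (Fp L) n ((Equiv.prodUnique (Fin (n + n)) (Fin 1)).symm.trans e₁) (Units.mul_inv a')⟩ :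
            Matrix.symplecticGroup (Fin n'') (Fp L)))⁻¹))).map
        (RingHom.snd (InfiniteAdeleRing (Fp L)) (FiniteAdeleRing (𝓞 (Fp L)) (Fp L))))) (isLocallyConstant_finSdChar _) φ)
    (Φ : piSchwartzBruhat (Fp L) (Fin n'')) (h : HA L e dV hdV dW hdW) :
    fourierCoeffDelta L e dV hdV dW hdW νN βw S (doubledLineThetaLift L e dV hdV dW hdW e₁ hdV0 hdW0 lam hlam a' hρ μW Φ fw) h = 0 := by
  -- move `h` into the datum (★ U4 under the integral sign)
  rw [fourierCoeffDelta_thetaLift_eq_at_one]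
  -- ★ (t): the lift as a linear map; ★ (c): the coefficient as a linear map on the class of continuous forms
  obtain ⟨Bl, hBl⟩ := exists_linearLift L e dV hdV dW hdW e₁ hdV0 hdW0 lam hlam a' hρ μW fw
  obtain ⟨cf, hcf⟩ := exists_linear_fourierCoeffDelta L e dV hdV dW hdW νN hβ.measurable hK hβK
    (continuousSubmodule (HA L e dV hdV dW hdW) ℂ ℂ) fun _ hF => hF
  -- every lift is continuous (★ p862640)
  have hPB : ∀ Ψ : piSchwartzBruhat (Fp L) (Fin n''), Bl Ψ ∈ continuousSubmodule (HA L e dV hdV dW hdW) ℂ ℂ := by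
    intro Ψ
    have hBΨ : Bl Ψ = doubledLineThetaLift L e dV hdV dW hdW e₁ hdV0 hdW0 lam hlam a' hρ μW Ψ fw := funext (hBl Ψ)
    change Continuous (Bl Ψ)
    rw [hBΨ]
    exact continuous_thetaFunctional L e dV hdV dW hdW e₁ hdV0 hdW0 lam hlam a' hρ μW fw
      (LinearMap.id : piSchwartzBruhat (Fp L) (Fin n'') →ₗ[ℂ] piSchwartzBruhat (Fp L) (Fin n''))
      (T₂ := fun Ψ' => doubledLineThetaLift L e dV hdV dW hdW e₁ hdV0 hdW0 lam hlam a' hρ μW Ψ' fw) (fun _ _ => rfl) Ψ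
  exact fourierCoeffDelta_thetaLift_eq_zero_of_lineCayley_fst L e dV hdV dW hdW e₁ hdV0 hdW0 lam hlam a' hρ μW fw νN hβ hβtop S Bl hBl
    (continuousSubmodule (HA L e dV hdV dW hdW) ℂ ℂ) hPB (cf S) (hcf S)
    σ hσ hσF π hπ ψ hψ ρf b hb a ha v hu hρm βloc hherm hdet χ hχ ι hχS hX hρf _

omit [IsFiniteMeasureOnCompacts νN] in
set_option maxHeartbeats 1000000 in -- idem
/-- **ROW `h2₂` FOR THE THETA SIDE AT THE LINE CAYLEY MOVER, ON ANY CLASS `P` WITH ANY COEFFICIENT MAP `cfS`** (no `Bl`, `hBl`, `hPB`): ★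
`coeff_comp_codRestrict_thetaFunctional_eq_zero` ∘ `fourierCoeffDelta_thetaLift_eq_zero_of_lineCayley_cont`.  At FACE-D₀: `P := P_k`, `cfS := coeff β = cf (dict β)`.
[cite: Rallis1984, §4] [cite: KudlaRallis1994, §3] [cite: Liu2021, App. B Prop. B.8 p. 104] -/
theorem h2Row_thetaSide_of_lineCayley_cont [IsFiniteMeasureOnCompacts νN]
    (hX : ∀ z, ((blk L e dV hdV dW hdW ((ι z : ↥(unipDelta L e dV hdV dW hdW)) : HA L e dV hdV dW hdW)).toBlocks₁₂).map (UnitaryGroup.adeleFst L) = 0)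
    (hρf : ∀ (z : Z) (φ : FinSB (Fp L) (Fin n'')), ρf z φ =
      finMulLM (finSdChar ((((-⅟(2 : AdeleRing (𝓞 (Fp L)) (Fp L))) • SiegelParabolicPi.cMat (ratSp (Fp L) (adelicGram (Fp L) e₁ (realDiagonal L (dD L e dV hdV dW hdW) (dD_conj L e dV hdV dW hdW)) (TW (Fp L) a'))
          (isUnit_det_adelicGram (Fp L) e₁
            (isUnit_det_realDiagonal L (dD L e dV hdV dW hdW) (dD_conj L e dV hdV dW hdW) (dD_ne_zero L e dV hdV dW hdW hdV0 hdW0))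
            (isUnit_det_TW (Fp L) a')) (⟨_, lineCayleyMover_mem_symplecticGroup (Fp L) n ((Equiv.prodUnique (Fin (n + n)) (Fin 1)).symm.trans e₁) (Units.mul_inv a')⟩ :
            Matrix.symplecticGroup (Fin n'') (Fp L)) *
        toSp (Fp L) L (IsCMField.complexConj L) (n + n) 1 e₁ (Matrix.diagonal (dD L e dV hdV dW hdW)) (JW (Fp L) L a')
          (complexConj_imagUnit L) (imagUnit_ne_zero L) (imagUnit_mul_self L)
          (realDiagonal_isSymm L (dD L e dV hdV dW hdW) (dD_conj L e dV hdV dW hdW)) (isSymm_TW (Fp L) a')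
          (realDiagonal_map L (dD L e dV hdV dW hdW) (dD_conj L e dV hdV dW hdW)).symm (JW_eq (Fp L) L a')
          (UnitaryGroup.adelicInl (Fp L) L (IsCMField.complexConj L) (n + n) 1 (Matrix.diagonal (dD L e dV hdV dW hdW)) (JW (Fp L) L a')
            (toDiagA L e dV hdV dW hdW ((ι z : ↥(unipDelta L e dV hdV dW hdW)) : HA L e dV hdV dW hdW))) *
        (ratSp (Fp L) (adelicGram (Fp L) e₁ (realDiagonal L (dD L e dV hdV dW hdW) (dD_conj L e dV hdV dW hdW)) (TW (Fp L) a'))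
          (isUnit_det_adelicGram (Fp L) e₁
            (isUnit_det_realDiagonal L (dD L e dV hdV dW hdW) (dD_conj L e dV hdV dW hdW) (dD_ne_zero L e dV hdV dW hdW hdV0 hdW0))
            (isUnit_det_TW (Fp L) a')) (⟨_, lineCayleyMover_mem_symplecticGroup (Fp L) n ((Equiv.prodUnique (Fin (n + n)) (Fin 1)).symm.trans e₁) (Units.mul_inv a')⟩ :
            Matrix.symplecticGroup (Fin n'') (Fp L)))⁻¹))).map
        (RingHom.snd (InfiniteAdeleRing (Fp L)) (FiniteAdeleRing (𝓞 (Fp L)) (Fp L))))) (isLocallyConstant_finSdChar _) φ)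
    (P : Submodule ℂ (HA L e dV hdV dW hdW → ℂ)) (cfS : ↥P →ₗ[ℂ] (HA L e dV hdV dW hdW → ℂ))
    (hcf : ∀ (y : ↥P) (h : HA L e dV hdV dW hdW), cfS y h = fourierCoeffDelta L e dV hdV dW hdW νN βw S (y : HA L e dV hdV dW hdW → ℂ) h)
    {D : Type*} [AddCommGroup D] [Module ℂ D] (𝓣 : D →ₗ[ℂ] piSchwartzBruhat (Fp L) (Fin n''))
    (T₂ : D →ₗ[ℂ] (HA L e dV hdV dW hdW → ℂ))
    (hT₂B : ∀ (x : D) (h : HA L e dV hdV dW hdW),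
      T₂ x h = doubledLineThetaLift L e dV hdV dW hdW e₁ hdV0 hdW0 lam hlam a' hρ μW (𝓣 x) fw h)
    (hP₂ : ∀ x, T₂ x ∈ P) :
    cfS ∘ₗ LinearMap.codRestrict P T₂ hP₂ = 0 :=
  coeff_comp_codRestrict_thetaFunctional_eq_zero L e dV hdV dW hdW e₁ hdV0 hdW0 lam hlam a' hρ μW fw νN βw S P cfS hcf 𝓣 T₂ hT₂B hP₂ fun Φ =>
    fourierCoeffDelta_thetaLift_eq_zero_of_lineCayley_cont L e dV hdV dW hdW e₁ hdV0 hdW0 lam hlam a' hρ μW fw νN hβ hβtop hK hβK S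
      σ hσ hσF π hπ ψ hψ ρf b hb a ha v hu hρm βloc hherm hdet χ hχ ι hχS hX hρf Φ 1

end Cont

end Summit.HodgeConjecture.HodgeConjecture.Cruxes.HLiu418.K2LiuFirstTermLineLiftRankRowAtPlace

end
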